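/-
Copyright: the b2b-balaban T⁴-continuum CRUX team, row NE7b OWNER lineage `t4-ne7b-p1` (gen 121). Project licence.
-/
import Summits.QuantumFields.BalabanUV.T4Continuum.Spine.NE7b.SupTorusCovarianceLocality

/-!
# ON THE STRICTLY CONVEX SINGLE-SITE CLASS `v₀ ≤ V ≤ Λ` (`v₀ > 0`) THE LOCALITY COLUMN IS POINTWISE — the discrete maximum principle for
# `(n+1)²(−Δ) + V` on the fine torus, with the block term `aQ′t*Q′t` moved to the right-hand side where (135)∕(138)∕(139) control it
# MESH-FREE: `‖H⁻¹f‖_∞ ≤ C‖f‖_∞` for `f` in one block, `|Dt e_{y₀}(x)| ≤ C` for the response, `‖Cf‖_∞ ≤ C‖f‖_∞` for the fluctuation part,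
# `C = C(d, a, v₀, Λ)`, EVERY site, every mesh, every volume — the `(n+1)^{d∕2}` of the `ℓ² → ℓ^∞` passage is GONE on this class;
# § [NE7bP1-G120-HANDOFF-FINAL] NEXT (3)(b) «an `ℓ^∞` theory for `H⁻¹`» in its easy regime (row NE7b, node U5c; (131)–(139) BY NAME; [folklore])

Cell `pub-balaban`, sub-cell `t4`, spine estimate NE7b (`T4WeightBudget.RelWeightBound`; the cell's OWN estimate — NOT PRINTED in
[Bałaban 1983–89], NOT PROVED).  Crux-route work under `Spine/NE7b/` by the row OWNER (`t4-ne7b-p1` gen 121, file (144)) under FREEZE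
(0)'s crux-prover clause; NOTHING of Bałaban's is named as a Lean object, valued or asserted; no `T4Continuum/Support` leaf typed; no `def`,
no notation (the action DISPLAYED; the response and the fluctuation part WRITTEN OUT, `T⁻¹` Mathlib's inverse of `Matrix.of T`); zero
`sorry`.  Imports (BY NAME): the OWNER's (139) `…SupTorusCovarianceLocality` (`coeff_le`, `covariance_local`; through it (138)
`blockMean_le_of_block_source`, (137) `response_local`, (135) `nextScale_hessian_local`, (133) `action_sum_smul`, `action_sub`,
`sum_indicator_mul`, (131) `exists_rate`, (89) TDF `siteOf_chart_surjective`, `blockOf_siteOf_of_mem`, TDFC `sum_block_comp_siteOf_eq`),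
Mathlib's `Finset.exists_max_image` ∕ `Finset.exists_min_image`.

WHY (located).  § NEXT (3)(b): «an `ℓ^∞` theory for `H⁻¹` … the maximum principle fails because `aQ′t*Q′t` has positive off-diagonal
entries».  It fails for `H`, not for `L_V = (n+1)²(−Δ) + V`: `L_V` IS a monotone (`M`-) matrix when `V > 0`, with `‖L_V⁻¹‖_{∞→∞} ≤ 1∕v₀` by the
maximum principle (at a maximum of `u` the Laplacian term is `≥ 0`, so `V·u ≤ L_Vu` there).  And `H = L_V + aΠ` with `Π` the block mean: the
block means of every object of the column are ALREADY controlled mesh-free — `Q′tH⁻¹f` by (138) `blockMean_le_of_block_source` at the size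
`√((n+1)^{−d}Σf²) ≤ ‖f‖_∞`, `Q′t(Dt e_{y₀}) = e_{y₀}` exactly ((137)), `Q′t(Cf) = 0` exactly ((139)) — so `L_Vu = f − aΠu`, `L_Vh = T⁻¹(bt ·, y₀) −
a𝟙_{B_{y₀}}`, `L_V(Cf) = f − c∘bt` (`c = T⁻¹Q′tu`, (139) `coeff_le`) all have right-hand sides bounded mesh-free, and the maximum principle
finishes.  The price is the class: `V ≥ v₀ > 0` (strictly convex single-site potential, `u″ ≥ v₀`), not the road's `V ≥ −λ` — for `V` of
either sign the Laplacian's Poincaré gain on block-mean-zero fields has no `ℓ^∞` counterpart without potential theory (open).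

WHAT IS PROVED ([folklore]; fine torus `Site d ((n+1)s)`, coarse `Site d s`, `[NeZero s]`; the action DISPLAYED; `bt x = σ_s(blk n (wm x))`;
`m_κ` as in (131) with `λ = −v₀`; `T(y,y′) = (n+1)^{−d}Σ_z ψ_{y′}(σ(chart (wm y) z))`, `Hψ_{y′} = 𝟙[bt · = y′]`):
* §1 **`maxPrinciple`** (`(n+1)²Σ_μ(2u x − u(x±ê_μ)) + V x·u x = F x`, `V ≥ v₀ > 0`, `|F| ≤ M` ⟹ `|u x| ≤ M∕v₀` everywhere), `blockTerm_eq` (the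
  block term at `x = σ(chart (wm y) z)` is the block sum over `y`).
* §2 (`V ≥ v₀ > 0`, `f` in the block `y₀`, `|f| ≤ M`, `Hu = f`) `blockRMS_le_of_block_source`, **`sup_le_of_block_source`** (`|u x| ≤ (M + a·m_κ⁻¹e^{2dκ}M)∕v₀`).
* §3 **`sup_le_of_blockConst_image`** (`Hh = c∘bt`, `|c| ≤ c₁`, block means of `h` bounded by `μ₀` ⟹ `|h x| ≤ (c₁ + aμ₀)∕v₀`; the response:
  `μ₀ = 1`).
* §4 THE HEADLINE **`pointwise_column`**: `∃ C > 0` from `(d, a, v₀, Λ)` only (`a > 0`, `v₀ > 0`, `Λ ≥ 0`) such that for ALL `n, s`, ALL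
  `v₀ ≤ V ≤ Λ`, ALL block columns `ψ`, every `y₀`, every `Hu = f` with `f` in the block `y₀`, `|f| ≤ M`, and EVERY site `x`: (i) `|u x| ≤ CM`;
  (ii) `|Σ_{y′}T⁻¹(y′,y₀)ψ_{y′}(x)| ≤ C`; (iii) `|(u − Σ_{y′}(Σ_{y″}T⁻¹(y′,y″)(n+1)^{−d}Σ_z u(σ(chart (wm y″) z)))ψ_{y′})(x)| ≤ CM`.
HONEST (what this is NOT).  The STRICTLY CONVEX single-site class only (`V ≥ v₀ > 0`); the road's class `V ≥ −λ`, `λ < min(2,a)` of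
either sign is NOT covered (there the `ℓ^∞` theory needs pointwise Green's function ∕ heat-kernel bounds — § NEXT (3)(b) stays open in
that regime); sup BOUNDS, not pointwise exponential DECAY (a comparison-function argument on the torus — not here); sources in one block;
constants explicit, far from sharp; cubic periods; scalar skeleton ((A3), NC-NE7b-α UNRULED); nothing of Bałaban's.  BY-NAME EFFECT ON THE
WALL: NONE.  NE7b NOT PRINTED ∕ NOT PROVED; spine PROVED 0∕9; rung (B)+1 on a FINITE torus — NOT infinite volume, NOT the mass gap, NOT Clay.
HONEST DEPENDENCY: continuum YM on T⁴ ⇐ BetaPertH ∧ nine spine estimates (0∕9 proved); BetaPertH ⇐ (D1) ∧ (D4) ∧ CAP+tail; G-an2-4 gates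
asym, D1 and NE2∕3∕4.
-/

set_option autoImplicit false

noncomputable section

namespace Summit.QuantumFields.BalabanUV.T4Continuum.NE7b.SupTorusMaximumPrinciple

open Real
open Literature.MathematicalPhysics.QuantumFieldTheory.Balaban1983to89
open B6QGQLower276 (X e blk B side chart mem_B sum_B sum_B_const card_cube blk_chart)
open Beta (Site siteOf windowMap siteOf_windowMap siteOf_add)
open SupTorusDirichletForm (siteOf_chart_surjective blockOf_siteOf_of_mem)
open SupTorusDirichletFormCoercive (sum_block_comp_siteOf_eq)
open SupTorusHessianCombesThomas (exists_rate)
open SupTorusCoarseFloor (nextScale_hessian_local)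
open SupTorusPropagatorLocality (blockMean_le_of_block_source)
open SupTorusCovarianceLocality (coeff_le)

variable {d : ℕ}

/-! ## §1. The discrete maximum principle for `(n+1)²(−Δ) + V`, `V ≥ v₀ > 0`, on the fine torus -/

section MaxPrinciple

variable (n s : ℕ) [NeZero s]

/-- **THE DISCRETE MAXIMUM PRINCIPLE ON THE TORUS**: if `(n+1)²Σ_μ(2u x − u(x+ê_μ) − u(x−ê_μ)) + V x·u x = F x` at every site with
`V ≥ v₀ > 0` and `|F| ≤ M`, then `|u x| ≤ M∕v₀` everywhere — at a maximum of `u` the Laplacian term is nonnegative, so `V·u ≤ F` there;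
symmetrically at a minimum.  No block term, no mesh or volume dependence. [folklore] -/
theorem maxPrinciple {v₀ M : ℝ} (hv₀ : 0 < v₀) (V u F : Site d ((n + 1) * s) → ℝ) (hV : ∀ x, v₀ ≤ V x) (hF : ∀ x, |F x| ≤ M)
    (hu : ∀ x, ((n : ℝ) + 1) ^ 2 * ∑ μ, (2 * u x - u (x + siteOf d ((n + 1) * s) (e μ)) - u (x - siteOf d ((n + 1) * s) (e μ)))
      + V x * u x = F x) (x : Site d ((n + 1) * s)) :
    |u x| ≤ M / v₀ := by
  classical
  have hM : 0 ≤ M := (abs_nonneg _).trans (hF x)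
  obtain ⟨xM, -, hxM⟩ := Finset.exists_max_image Finset.univ u ⟨x, Finset.mem_univ x⟩
  obtain ⟨xm, -, hxm⟩ := Finset.exists_min_image Finset.univ u ⟨x, Finset.mem_univ x⟩
  have hlapM : 0 ≤ ∑ μ : Fin d, (2 * u xM - u (xM + siteOf d ((n + 1) * s) (e μ)) - u (xM - siteOf d ((n + 1) * s) (e μ))) := by
    refine Finset.sum_nonneg fun μ _ => ?_
    have h1 := hxM (xM + siteOf d ((n + 1) * s) (e μ)) (Finset.mem_univ _)
    have h2 := hxM (xM - siteOf d ((n + 1) * s) (e μ)) (Finset.mem_univ _)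
    linarith
  have hlapm : ∑ μ : Fin d, (2 * u xm - u (xm + siteOf d ((n + 1) * s) (e μ)) - u (xm - siteOf d ((n + 1) * s) (e μ))) ≤ 0 := by
    refine Finset.sum_nonpos fun μ _ => ?_
    have h1 := hxm (xm + siteOf d ((n + 1) * s) (e μ)) (Finset.mem_univ _)
    have h2 := hxm (xm - siteOf d ((n + 1) * s) (e μ)) (Finset.mem_univ _)
    linarith
  have hsq : (0 : ℝ) ≤ ((n : ℝ) + 1) ^ 2 := by positivity
  have hup : u x ≤ M / v₀ := by
    rw [le_div_iff₀ hv₀]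
    by_cases h0 : 0 ≤ u xM
    · have h1 : V xM * u xM ≤ M := by
        have := hu xM
        nlinarith [mul_nonneg hsq hlapM, (abs_le.1 (hF xM)).2]
      calc u x * v₀ ≤ u xM * v₀ := mul_le_mul_of_nonneg_right (hxM x (Finset.mem_univ x)) hv₀.le
        _ ≤ u xM * V xM := mul_le_mul_of_nonneg_left (hV xM) h0
        _ ≤ M := by rw [mul_comm]; exact h1
    · have : u x ≤ 0 := (hxM x (Finset.mem_univ x)).trans (le_of_lt (not_le.1 h0))
      nlinarith
  have hlo : -(M / v₀) ≤ u x := by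
    rw [neg_le, le_div_iff₀ hv₀]
    by_cases h0 : u xm ≤ 0
    · have h1 : -M ≤ V xm * u xm := by
        have := hu xm
        nlinarith [mul_nonpos_iff.2 (Or.inl ⟨hsq, hlapm⟩), (abs_le.1 (hF xm)).1]
      have h2 : V xm * u xm ≤ v₀ * u xm := mul_le_mul_of_nonpos_right (hV xm) h0
      have h3 : u xm ≤ u x := hxm x (Finset.mem_univ x)
      nlinarith
    · have : 0 ≤ u x := (le_of_lt (not_le.1 h0)).trans (hxm x (Finset.mem_univ x))
      nlinarith
  exact abs_le.2 ⟨hlo, hup⟩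

/-- **THE BLOCK TERM OF THE DISPLAYED ACTION IS THE BLOCK SUM**: for `x = σ(chart n (wm y) z)`,
`Σ_{q ∈ B n (blk n (wm x))} u(σ q) = Σ_{z′} u(σ(chart n (wm y) z′))` — so `H = L_V + a·Π` with `Π` the block mean read at the block of `x`.
[folklore] -/
theorem blockTerm_eq (u : Site d ((n + 1) * s) → ℝ) (y : Site d s) (z : Fin d → Fin (n + 1)) :
    ∑ q ∈ B n (blk n (windowMap d ((n + 1) * s) (siteOf d ((n + 1) * s) (chart n (windowMap d s y) z)))), u (siteOf d ((n + 1) * s) q)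
      = ∑ z' : Fin d → Fin (n + 1), u (siteOf d ((n + 1) * s) (chart n (windowMap d s y) z')) := by
  rw [sum_block_comp_siteOf_eq n s u (mem_B.2 (blk_chart n (windowMap d s y) z)), sum_B]

end MaxPrinciple

/-! ## §2. On the strictly convex single-site class `V ≥ v₀ > 0` the column is POINTWISE -/

section Pointwise

variable (n : ℕ) (a : ℝ) (s : ℕ) [NeZero s] (ha : 0 ≤ a) {v₀ κ M : ℝ} (hv₀ : 0 < v₀) (hκ0 : 0 ≤ κ) (hκ1 : κ ≤ 1)
  (hm : 0 < min 2 a - (-v₀) - 2 * d * κ ^ 2 - a * (exp (2 * d * κ) - 1))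
  (V : Site d ((n + 1) * s) → ℝ) (hV : ∀ x, v₀ ≤ V x) (y₀ : Site d s) (u f : Site d ((n + 1) * s) → ℝ)
  (hf : ∀ x, siteOf d s (blk n (windowMap d ((n + 1) * s) x)) ≠ y₀ → f x = 0) (hfM : ∀ x, |f x| ≤ M)
  (hu : ∀ x, ((n : ℝ) + 1) ^ 2 * ∑ μ, (2 * u x - u (x + siteOf d ((n + 1) * s) (e μ)) - u (x - siteOf d ((n + 1) * s) (e μ)))
      + a / ((n : ℝ) + 1) ^ d * ∑ q ∈ B n (blk n (windowMap d ((n + 1) * s) x)), u (siteOf d ((n + 1) * s) q) + V x * u x = f x)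

include hf hfM in
/-- A source supported in one block with `|f| ≤ M` has block-RMS size `√((n+1)^{−d}Σf²) ≤ M`. [folklore] -/
theorem blockRMS_le_of_block_source : √((((n : ℝ) + 1) ^ d)⁻¹ * ∑ x, f x ^ 2) ≤ M := by
  classical
  have hM : 0 ≤ M := (abs_nonneg _).trans (hfM (siteOf d ((n + 1) * s) (chart n (windowMap d s y₀) 0)))
  have hvol : (0 : ℝ) < ((n : ℝ) + 1) ^ d := by positivity
  have hsum : ∑ x, f x ^ 2 ≤ ((n : ℝ) + 1) ^ d * M ^ 2 := by
    have e2 : ∀ x, f x ^ 2 = (if siteOf d s (blk n (windowMap d ((n + 1) * s) x)) = y₀ then (1 : ℝ) else 0) * f x ^ 2 := by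
      intro x
      by_cases hx : siteOf d s (blk n (windowMap d ((n + 1) * s) x)) = y₀
      · rw [if_pos hx, one_mul]
      · rw [if_neg hx, hf x hx]; ring
    rw [Finset.sum_congr rfl fun x _ => e2 x, SupTorusActionForm.sum_indicator_mul n s y₀]
    calc ∑ z : Fin d → Fin (n + 1), f (siteOf d ((n + 1) * s) (chart n (windowMap d s y₀) z)) ^ 2
        ≤ ∑ _z : Fin d → Fin (n + 1), M ^ 2 := Finset.sum_le_sum fun z _ => by
          rw [← sq_abs]; exact pow_le_pow_left₀ (abs_nonneg _) (hfM _) 2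
      _ = ((n : ℝ) + 1) ^ d * M ^ 2 := by rw [Finset.sum_const, Finset.card_univ, nsmul_eq_mul, card_cube]
  calc √((((n : ℝ) + 1) ^ d)⁻¹ * ∑ x, f x ^ 2) ≤ √(M ^ 2) :=
        Real.sqrt_le_sqrt (by rw [inv_mul_le_iff₀ hvol]; exact hsum)
    _ = M := Real.sqrt_sq hM

include ha hv₀ hκ0 hκ1 hm hV hf hfM hu in
/-- **`H⁻¹` IS BOUNDED ON `ℓ^∞`, MESH-FREE, ON THE STRICTLY CONVEX CLASS**: if `Hu = f` (displayed action, `V ≥ v₀ > 0`), `f` supported in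
the block `y₀` with `|f| ≤ M`, then at EVERY site `|u x| ≤ (M + a·m_κ⁻¹e^{2dκ}·M)∕v₀` — the maximum principle for `L_V = (n+1)²(−Δ) + V`
applied to `L_V u = f − a·(block mean of u)`, the block means being `≤ m_κ⁻¹e^{2dκ}√((n+1)^{−d}Σf²)` by (138).  No `(n+1)^{d∕2}`. [folklore] -/
theorem sup_le_of_block_source (x : Site d ((n + 1) * s)) :
    |u x| ≤ (M + a * ((min 2 a - (-v₀) - 2 * d * κ ^ 2 - a * (exp (2 * d * κ) - 1))⁻¹ * exp (2 * d * κ) * M)) / v₀ := by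
  classical
  have hM : 0 ≤ M := (abs_nonneg _).trans (hfM x)
  have hvol : (0 : ℝ) < ((n : ℝ) + 1) ^ d := by positivity
  set m := min 2 a - (-v₀) - 2 * d * κ ^ 2 - a * (exp (2 * d * κ) - 1) with hm_def
  -- the block means of `u` are bounded by `m⁻¹e^{2dκ}M`
  have hmean : ∀ y : Site d s, |(((n : ℝ) + 1) ^ d)⁻¹ * ∑ z : Fin d → Fin (n + 1), u (siteOf d ((n + 1) * s) (chart n (windowMap d s y) z))|
      ≤ m⁻¹ * exp (2 * d * κ) * M := by
    intro y
    have h := blockMean_le_of_block_source n a s ha hκ0 hκ1 hm V (fun x => by linarith [hV x]) y₀ u f hf hu y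
    have hR := blockRMS_le_of_block_source n s y₀ f hf hfM
    have hm0 : 0 ≤ m⁻¹ * exp (2 * d * κ) := mul_nonneg (inv_nonneg.2 hm.le) (exp_pos _).le
    refine h.trans ?_
    calc m⁻¹ * exp (2 * d * κ) * √((((n : ℝ) + 1) ^ d)⁻¹ * ∑ x, f x ^ 2) * exp (-(κ * ∑ i, (((y i - y₀ i).valMinAbs.natAbs : ℕ) : ℝ)))
        ≤ m⁻¹ * exp (2 * d * κ) * M * 1 := by
          refine mul_le_mul (mul_le_mul_of_nonneg_left hR hm0) ?_ (exp_pos _).le (by positivity)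
          exact exp_le_one_iff.2 (by
            have : 0 ≤ ∑ i, (((y i - y₀ i).valMinAbs.natAbs : ℕ) : ℝ) := Finset.sum_nonneg fun _ _ => Nat.cast_nonneg _
            nlinarith)
      _ = _ := mul_one _
  -- `L_V u = f − a·(block mean)` with `|RHS| ≤ M + a m⁻¹e^{2dκ}M`
  refine maxPrinciple n s hv₀ V u (fun x => f x - a / ((n : ℝ) + 1) ^ d
      * ∑ q ∈ B n (blk n (windowMap d ((n + 1) * s) x)), u (siteOf d ((n + 1) * s) q)) hV (fun x' => ?_) (fun x' => by linarith [hu x']) x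
  obtain ⟨⟨y, z⟩, hyz⟩ := siteOf_chart_surjective n s x'
  simp only at hyz
  rw [← hyz, blockTerm_eq n s u y z, div_eq_mul_inv, mul_assoc]
  have h1 := hmean y
  have h2 := hfM (siteOf d ((n + 1) * s) (chart n (windowMap d s y) z))
  calc |f (siteOf d ((n + 1) * s) (chart n (windowMap d s y) z))
        - a * ((((n : ℝ) + 1) ^ d)⁻¹ * ∑ z' : Fin d → Fin (n + 1), u (siteOf d ((n + 1) * s) (chart n (windowMap d s y) z')))|
      ≤ |f (siteOf d ((n + 1) * s) (chart n (windowMap d s y) z))|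
        + |a * ((((n : ℝ) + 1) ^ d)⁻¹ * ∑ z' : Fin d → Fin (n + 1), u (siteOf d ((n + 1) * s) (chart n (windowMap d s y) z')))| :=
        abs_sub _ _
    _ ≤ M + a * (m⁻¹ * exp (2 * d * κ) * M) := by
        rw [abs_mul, abs_of_nonneg ha]
        exact add_le_add h2 (mul_le_mul_of_nonneg_left h1 ha)

end Pointwise

/-! ## §3. The response and the fluctuation part, pointwise, on the strictly convex class -/

section Response

variable (n : ℕ) (a : ℝ) (s : ℕ) [NeZero s] (ha : 0 ≤ a) {v₀ c₁ : ℝ} (hv₀ : 0 < v₀)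
  (V : Site d ((n + 1) * s) → ℝ) (hV : ∀ x, v₀ ≤ V x) (y₀ : Site d s) (c : Site d s → ℝ) (hc : ∀ y', |c y'| ≤ c₁)
  (h : Site d ((n + 1) * s) → ℝ)
  (hh : ∀ x, ((n : ℝ) + 1) ^ 2 * ∑ μ, (2 * h x - h (x + siteOf d ((n + 1) * s) (e μ)) - h (x - siteOf d ((n + 1) * s) (e μ)))
      + a / ((n : ℝ) + 1) ^ d * ∑ q ∈ B n (blk n (windowMap d ((n + 1) * s) x)), h (siteOf d ((n + 1) * s) q) + V x * h x
      = c (siteOf d s (blk n (windowMap d ((n + 1) * s) x))))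

include ha hv₀ hV hc hh in
/-- **A FIELD WITH BLOCK-CONSTANT `H`-IMAGE AND KNOWN BLOCK MEANS IS BOUNDED POINTWISE**: if `Hh = c∘bt` with `|c| ≤ c₁`, `V ≥ v₀ > 0`, and the
block means of `h` satisfy `|(n+1)^{−d}Σ_z h(σ(chart (wm y) z))| ≤ μ₀` for every block, then `|h x| ≤ (c₁ + a·μ₀)∕v₀` at EVERY site.  For the
road's response `h_{y₀} = Dt e_{y₀}` (`c = T⁻¹(·,y₀)`, block means `e_{y₀}`, `μ₀ = 1`): `|h_{y₀}(x)| ≤ (c₁ + a)∕v₀` — POINTWISE, mesh-free. [folklore] -/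
theorem sup_le_of_blockConst_image {μ₀ : ℝ}
    (hmean : ∀ y : Site d s, |(((n : ℝ) + 1) ^ d)⁻¹ * ∑ z : Fin d → Fin (n + 1), h (siteOf d ((n + 1) * s) (chart n (windowMap d s y) z))| ≤ μ₀)
    (x : Site d ((n + 1) * s)) : |h x| ≤ (c₁ + a * μ₀) / v₀ := by
  classical
  refine maxPrinciple n s hv₀ V h (fun x => c (siteOf d s (blk n (windowMap d ((n + 1) * s) x))) - a / ((n : ℝ) + 1) ^ d
      * ∑ q ∈ B n (blk n (windowMap d ((n + 1) * s) x)), h (siteOf d ((n + 1) * s) q)) hV (fun x' => ?_) (fun x' => by linarith [hh x']) x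
  obtain ⟨⟨y, z⟩, hyz⟩ := siteOf_chart_surjective n s x'
  simp only at hyz
  rw [← hyz, blockTerm_eq n s h y z, div_eq_mul_inv, mul_assoc]
  have h1 := hmean y
  have h2 := hc (siteOf d s (blk n (windowMap d ((n + 1) * s) (siteOf d ((n + 1) * s) (chart n (windowMap d s y) z)))))
  calc |c (siteOf d s (blk n (windowMap d ((n + 1) * s) (siteOf d ((n + 1) * s) (chart n (windowMap d s y) z)))))
        - a * ((((n : ℝ) + 1) ^ d)⁻¹ * ∑ z' : Fin d → Fin (n + 1), h (siteOf d ((n + 1) * s) (chart n (windowMap d s y) z')))|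
      ≤ |c (siteOf d s (blk n (windowMap d ((n + 1) * s) (siteOf d ((n + 1) * s) (chart n (windowMap d s y) z)))))|
        + |a * ((((n : ℝ) + 1) ^ d)⁻¹ * ∑ z' : Fin d → Fin (n + 1), h (siteOf d ((n + 1) * s) (chart n (windowMap d s y) z')))| :=
        abs_sub _ _
    _ ≤ c₁ + a * μ₀ := by
        rw [abs_mul, abs_of_nonneg ha]
        exact add_le_add h2 (mul_le_mul_of_nonneg_left h1 ha)

end Response

/-! ## §4. THE END on the strictly convex class: propagator, response and fluctuation part are bounded POINTWISE, mesh- and volume-free -/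

/-- **HEADLINE — ON THE STRICTLY CONVEX SINGLE-SITE CLASS `v₀ ≤ V ≤ Λ` (`v₀ > 0`) THE LOCALITY COLUMN IS POINTWISE.**  Fix `d`, `a > 0`,
`0 < v₀`, `Λ ≥ 0`.  THERE IS `C > 0` (a function of these only) such that for ALL `n, s`, ALL `v₀ ≤ V ≤ Λ`, ALL block columns `ψ`
(`Hψ_{y′} = 𝟙[bt · = y′]`), every block `y₀`, every `u, f` with `Hu = f`, `f` supported in the block `y₀` and `|f| ≤ M`, and EVERY fine site `x`:
(i) `|u x| ≤ C·M` (the propagator `H⁻¹` on `ℓ^∞`); (ii) `|h_{y₀}(x)| ≤ C` for the response `h_{y₀} = Σ_{y′}T⁻¹(y′,y₀)ψ_{y′}` (`= Dt e_{y₀}`);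
(iii) `|(u − h)(x)| ≤ C·M` for the fluctuation part `h = Σ_{y′}(Σ_{y″}T⁻¹(y′,y″)(n+1)^{−d}Σ_z u(σ(chart (wm y″) z)))ψ_{y′}` (`u − h = Cf`).
The maximum principle for `(n+1)²(−Δ) + V` with the block term moved to the right, where (135)∕(138)∕(139) control it MESH-FREE: the
`(n+1)^{d∕2}` of the `ℓ² → ℓ^∞` passage is GONE on this class. [folklore] -/
theorem pointwise_column (a : ℝ) (ha : 0 < a) {v₀ Lam : ℝ} (hv₀ : 0 < v₀) (hLam : 0 ≤ Lam) :
    ∃ C : ℝ, 0 < C ∧ ∀ (n s : ℕ) [NeZero s] (V : Site d ((n + 1) * s) → ℝ), (∀ x, v₀ ≤ V x) → (∀ x, V x ≤ Lam) →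
      ∀ ψ : Site d s → Site d ((n + 1) * s) → ℝ,
      (∀ y' x, ((n : ℝ) + 1) ^ 2 * ∑ μ, (2 * ψ y' x - ψ y' (x + siteOf d ((n + 1) * s) (e μ)) - ψ y' (x - siteOf d ((n + 1) * s) (e μ)))
        + a / ((n : ℝ) + 1) ^ d * ∑ q ∈ B n (blk n (windowMap d ((n + 1) * s) x)), ψ y' (siteOf d ((n + 1) * s) q) + V x * ψ y' x
        = if siteOf d s (blk n (windowMap d ((n + 1) * s) x)) = y' then 1 else 0) →
      ∀ (y₀ : Site d s) (M : ℝ) (u f : Site d ((n + 1) * s) → ℝ), (∀ x, siteOf d s (blk n (windowMap d ((n + 1) * s) x)) ≠ y₀ → f x = 0) →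
      (∀ x, |f x| ≤ M) →
      (∀ x, ((n : ℝ) + 1) ^ 2 * ∑ μ, (2 * u x - u (x + siteOf d ((n + 1) * s) (e μ)) - u (x - siteOf d ((n + 1) * s) (e μ)))
        + a / ((n : ℝ) + 1) ^ d * ∑ q ∈ B n (blk n (windowMap d ((n + 1) * s) x)), u (siteOf d ((n + 1) * s) q) + V x * u x = f x) →
      ∀ x : Site d ((n + 1) * s),
        |u x| ≤ C * M ∧
        |∑ y', (Matrix.of fun yy y'' : Site d s =>
            (((n : ℝ) + 1) ^ d)⁻¹ * ∑ z : Fin d → Fin (n + 1), ψ y'' (siteOf d ((n + 1) * s) (chart n (windowMap d s yy) z)))⁻¹ y' y₀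
            * ψ y' x| ≤ C ∧
        |u x - ∑ y', (∑ y'', (Matrix.of fun yy y'' : Site d s =>
              (((n : ℝ) + 1) ^ d)⁻¹ * ∑ z : Fin d → Fin (n + 1), ψ y'' (siteOf d ((n + 1) * s) (chart n (windowMap d s yy) z)))⁻¹ y' y''
            * ((((n : ℝ) + 1) ^ d)⁻¹ * ∑ z'' : Fin d → Fin (n + 1), u (siteOf d ((n + 1) * s) (chart n (windowMap d s y'') z''))))
            * ψ y' x| ≤ C * M := by
  classical
  have hd : (0 : ℝ) ≤ d := Nat.cast_nonneg d
  have hm0 : 0 < min 2 a - (-v₀) := by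
    have : 0 ≤ min 2 a := le_min zero_le_two ha.le
    linarith
  obtain ⟨κ, hκ0, hκ1, hκm⟩ := exists_rate (d := d) a ha.le hm0
  have hm : 0 < min 2 a - (-v₀) - 2 * d * κ ^ 2 - a * (exp (2 * d * κ) - 1) := by linarith
  obtain ⟨c₁, δ₁, hc₁, hδ₁, H135⟩ := nextScale_hessian_local (d := d) a ha hm0 hLam
  obtain ⟨C139, δ139, hC139, -, H139⟩ := SupTorusCovarianceLocality.covariance_local (d := d) a ha hm0 hLam
  set m := min 2 a - (-v₀) - 2 * d * κ ^ 2 - a * (exp (2 * d * κ) - 1) with hm_def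
  set δ : ℝ := min δ₁ (κ / 2) with hδ_def
  have hδ0 : 0 < δ := lt_min hδ₁ (by linarith)
  have hδδ₁ : δ ≤ δ₁ := min_le_left _ _
  have h2δ : 2 * δ ≤ κ := by have := min_le_right δ₁ (κ / 2); rw [← hδ_def] at this; linarith
  set K : ℝ := (2 * (1 - exp (-δ))⁻¹) ^ d with hK
  have hK0 : 0 ≤ K := pow_nonneg (mul_nonneg zero_le_two (inv_nonneg.2 (sub_nonneg.2 (exp_le_one_iff.2 (by linarith))))) d
  have hminv : 0 ≤ m⁻¹ := inv_nonneg.2 hm.le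
  refine ⟨((1 + a * (m⁻¹ * exp (2 * d * κ))) / v₀ + (c₁ + a) / v₀ + (1 + c₁ * (m⁻¹ * exp (2 * d * κ)) * K) / v₀) + 1,
    by positivity, ?_⟩
  intro n s _ V hV hV' ψ hψ y₀ M u f hf hfM hu x
  set T : Matrix (Site d s) (Site d s) ℝ := Matrix.of fun yy y'' : Site d s =>
    (((n : ℝ) + 1) ^ d)⁻¹ * ∑ z : Fin d → Fin (n + 1), ψ y'' (siteOf d ((n + 1) * s) (chart n (windowMap d s yy) z)) with hT_def
  have hM : 0 ≤ M := (abs_nonneg _).trans (hfM x)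
  have hVl : ∀ x, -(-v₀) ≤ V x := fun x => by linarith [hV x]
  have hTinv : ∀ y y' : Site d s, |T⁻¹ y y'| ≤ c₁ * exp (-(δ₁ * ∑ i, (((y i - y' i).valMinAbs.natAbs : ℕ) : ℝ))) :=
    fun y y' => H135 n s V hVl hV' ψ hψ y y'
  have hTinv' : ∀ y y' : Site d s, |T⁻¹ y y'| ≤ c₁ := fun y y' => (hTinv y y').trans (by
    have : 0 ≤ ∑ i, (((y i - y' i).valMinAbs.natAbs : ℕ) : ℝ) := Finset.sum_nonneg fun _ _ => Nat.cast_nonneg _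
    exact (mul_le_mul_of_nonneg_left (exp_le_one_iff.2 (by nlinarith)) hc₁.le).trans (le_of_eq (mul_one _)))
  have hP1 : 0 ≤ (1 + a * (m⁻¹ * exp (2 * d * κ))) / v₀ := by positivity
  have hP2 : 0 ≤ (c₁ + a) / v₀ := by positivity
  have hP3 : 0 ≤ (1 + c₁ * (m⁻¹ * exp (2 * d * κ)) * K) / v₀ := by positivity
  refine ⟨?_, ?_, ?_⟩
  · -- (i) the propagator
    have h1 := sup_le_of_block_source n a s ha.le hv₀ hκ0.le hκ1 hm V hV y₀ u f hf hfM hu x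
    have e1 : (M + a * (m⁻¹ * exp (2 * d * κ) * M)) / v₀ = (1 + a * (m⁻¹ * exp (2 * d * κ))) / v₀ * M := by ring
    rw [e1] at h1
    exact h1.trans (mul_le_mul_of_nonneg_right (by linarith) hM)
  · -- (ii) the response: `Hh = T⁻¹(bt ·, y₀)`, block means `e_{y₀}`
    obtain ⟨C7, δ7, -, -, H137⟩ := SupTorusResponseLocality.response_local (d := d) a ha hm0 hLam
    obtain ⟨hQ, hH, -⟩ := H137 n s V hVl hV' ψ hψ y₀
    have hmean : ∀ y : Site d s, |(((n : ℝ) + 1) ^ d)⁻¹ * ∑ z : Fin d → Fin (n + 1),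
        (∑ y', T⁻¹ y' y₀ * ψ y' (siteOf d ((n + 1) * s) (chart n (windowMap d s y) z)))| ≤ 1 := by
      intro y; rw [hQ y]; split_ifs <;> norm_num
    have h2 := sup_le_of_blockConst_image n a s ha.le hv₀ V hV (fun y' => T⁻¹ y' y₀) (fun y' => hTinv' y' y₀)
      (fun x => ∑ y', T⁻¹ y' y₀ * ψ y' x) hH hmean x
    rw [mul_one] at h2
    exact h2.trans (by linarith)
  · -- (iii) the fluctuation part: `H(u − h) = f − c∘bt`, zero block means
    obtain ⟨-, hQ0, -⟩ := H139 n s V hVl hV' ψ hψ y₀ u f hf hu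
    set cc : Site d s → ℝ := fun y' => ∑ y'', T⁻¹ y' y''
      * ((((n : ℝ) + 1) ^ d)⁻¹ * ∑ z'' : Fin d → Fin (n + 1), u (siteOf d ((n + 1) * s) (chart n (windowMap d s y'') z''))) with hcc
    set hfl : Site d ((n + 1) * s) → ℝ := fun x => ∑ y', cc y' * ψ y' x with hhfl
    have hcoef : ∀ y', |cc y'| ≤ c₁ * (m⁻¹ * exp (2 * d * κ) * √((((n : ℝ) + 1) ^ d)⁻¹ * ∑ x, f x ^ 2)) * K
        * exp (-(δ * ∑ i, (((y' i - y₀ i).valMinAbs.natAbs : ℕ) : ℝ))) :=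
      fun y' => coeff_le n a s V (fun y' y'' => T⁻¹ y' y'') u ha.le hκ0.le hκ1 hm hδ0 hδδ₁ h2δ hc₁.le hVl hTinv y₀ f hf hu y'
    have hR := blockRMS_le_of_block_source n s y₀ f hf hfM
    have hcoef' : ∀ y', |cc y'| ≤ c₁ * (m⁻¹ * exp (2 * d * κ)) * K * M := by
      intro y'
      have hρ : 0 ≤ ∑ i, (((y' i - y₀ i).valMinAbs.natAbs : ℕ) : ℝ) := Finset.sum_nonneg fun _ _ => Nat.cast_nonneg _
      refine (hcoef y').trans ?_
      calc c₁ * (m⁻¹ * exp (2 * d * κ) * √((((n : ℝ) + 1) ^ d)⁻¹ * ∑ x, f x ^ 2)) * K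
            * exp (-(δ * ∑ i, (((y' i - y₀ i).valMinAbs.natAbs : ℕ) : ℝ)))
          ≤ c₁ * (m⁻¹ * exp (2 * d * κ) * M) * K * 1 :=
            mul_le_mul (mul_le_mul_of_nonneg_right (mul_le_mul_of_nonneg_left (mul_le_mul_of_nonneg_left hR (by positivity)) hc₁.le)
              hK0) (exp_le_one_iff.2 (by nlinarith)) (exp_pos _).le (by positivity)
        _ = _ := by ring
    -- the displays of `u − hfl`: action `f − cc∘bt`, block means zero
    have hHfl : ∀ x, ((n : ℝ) + 1) ^ 2 * ∑ μ, (2 * hfl x - hfl (x + siteOf d ((n + 1) * s) (e μ)) - hfl (x - siteOf d ((n + 1) * s) (e μ)))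
        + a / ((n : ℝ) + 1) ^ d * ∑ q ∈ B n (blk n (windowMap d ((n + 1) * s) x)), hfl (siteOf d ((n + 1) * s) q) + V x * hfl x
        = cc (siteOf d s (blk n (windowMap d ((n + 1) * s) x))) := by
      intro x
      simp only [hhfl]
      rw [SupTorusActionForm.action_sum_smul n a s Finset.univ cc ψ V x]
      simp only [hψ, mul_ite, mul_one, mul_zero, Finset.sum_ite_eq, Finset.mem_univ, if_true]
    have hdiff : ∀ x, ((n : ℝ) + 1) ^ 2 * ∑ μ, (2 * (u x - hfl x) - (u (x + siteOf d ((n + 1) * s) (e μ)) - hfl (x + siteOf d ((n + 1) * s) (e μ)))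
          - (u (x - siteOf d ((n + 1) * s) (e μ)) - hfl (x - siteOf d ((n + 1) * s) (e μ))))
        + a / ((n : ℝ) + 1) ^ d * ∑ q ∈ B n (blk n (windowMap d ((n + 1) * s) x)), (u (siteOf d ((n + 1) * s) q) - hfl (siteOf d ((n + 1) * s) q))
        + V x * (u x - hfl x)
        = (fun y' => (if y' = y₀ then f x else 0) - cc y') (siteOf d s (blk n (windowMap d ((n + 1) * s) x))) := by
      intro x
      rw [SupTorusActionForm.action_sub n a s V u hfl x, hu x, hHfl x]
      by_cases hx : siteOf d s (blk n (windowMap d ((n + 1) * s) x)) = y₀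
      · simp only [hx, if_true]
      · simp only [hx, if_false, hf x hx]
    have hmean0 : ∀ y : Site d s, |(((n : ℝ) + 1) ^ d)⁻¹ * ∑ z : Fin d → Fin (n + 1),
        (u (siteOf d ((n + 1) * s) (chart n (windowMap d s y) z)) - hfl (siteOf d ((n + 1) * s) (chart n (windowMap d s y) z)))| ≤ 0 := by
      intro y
      have h0 := hQ0 y
      simp only [hhfl, hcc] at h0 ⊢
      rw [h0, abs_zero]
    have h3 := maxPrinciple n s hv₀ V (fun x => u x - hfl x) (fun x => (if siteOf d s (blk n (windowMap d ((n + 1) * s) x)) = y₀ then f x else 0)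
        - cc (siteOf d s (blk n (windowMap d ((n + 1) * s) x)))
        - a / ((n : ℝ) + 1) ^ d * ∑ q ∈ B n (blk n (windowMap d ((n + 1) * s) x)), (u (siteOf d ((n + 1) * s) q) - hfl (siteOf d ((n + 1) * s) q)))
      hV (M := M + c₁ * (m⁻¹ * exp (2 * d * κ)) * K * M) (fun x' => ?_) (fun x' => by have := hdiff x'; simp only at this; linarith) x
    · have e3 : (M + c₁ * (m⁻¹ * exp (2 * d * κ)) * K * M) / v₀ = (1 + c₁ * (m⁻¹ * exp (2 * d * κ)) * K) / v₀ * M := by ring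
      rw [e3] at h3
      simp only [hhfl, hcc] at h3
      exact h3.trans (mul_le_mul_of_nonneg_right (by linarith) hM)
    · obtain ⟨⟨y, z⟩, hyz⟩ := siteOf_chart_surjective n s x'
      simp only at hyz
      rw [← hyz, blockTerm_eq n s (fun x => u x - hfl x) y z]
      have hz := hmean0 y
      have hblk : siteOf d s (blk n (windowMap d ((n + 1) * s) (siteOf d ((n + 1) * s) (chart n (windowMap d s y) z)))) = y :=
        blockOf_siteOf_of_mem n s (mem_B.2 (blk_chart n (windowMap d s y) z))
      rw [hblk]
      have hzero : ∑ z' : Fin d → Fin (n + 1), (u (siteOf d ((n + 1) * s) (chart n (windowMap d s y) z'))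
          - hfl (siteOf d ((n + 1) * s) (chart n (windowMap d s y) z'))) = 0 := by
        have hvol : (0 : ℝ) < ((n : ℝ) + 1) ^ d := by positivity
        have := abs_nonpos_iff.1 hz
        rcases mul_eq_zero.1 this with h | h
        · exact absurd h (inv_ne_zero hvol.ne')
        · exact h
      rw [hzero, mul_zero, sub_zero]
      have hfx : |(if y = y₀ then f (siteOf d ((n + 1) * s) (chart n (windowMap d s y) z)) else 0)| ≤ M := by
        split_ifs
        · exact hfM _
        · rw [abs_zero]; exact hM
      calc |(if y = y₀ then f (siteOf d ((n + 1) * s) (chart n (windowMap d s y) z)) else 0) - cc y|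
          ≤ |(if y = y₀ then f (siteOf d ((n + 1) * s) (chart n (windowMap d s y) z)) else 0)| + |cc y| := abs_sub _ _
        _ ≤ M + c₁ * (m⁻¹ * exp (2 * d * κ)) * K * M := add_le_add hfx (hcoef' y)

/-! ## §5. Toy -/

/-- Toy (`d = 0`, `a = v₀ = Λ = 1`): the headline's hypotheses are inhabited, so the constant exists. -/
example : ∃ C : ℝ, 0 < C := let ⟨C, hC, _⟩ := pointwise_column (d := 0) 1 one_pos (v₀ := 1) (Lam := 1) one_pos zero_le_one; ⟨C, hC⟩

end Summit.QuantumFields.BalabanUV.T4Continuum.NE7b.SupTorusMaximumPrinciple
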